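import Summits.QuantumFields.YangMills.Theorems.FluctuationComparisonRegPrIntLS2BetaChartReadDerivLipschitz
import HarnessLib

/-!
# S2β · (β-3)′ FILE A — THE OSCILLATION SPLIT OF THE ORDER-2 CHART REMAINDER: for ANY reference field `X̄` in the polydisc,
# `‖ψ_{U₀}(X)c − Dψ_{U₀}(0)X c‖ ≤ 8B·‖X − X̄‖²∕(a − ‖X̄‖)² + 32B·‖X̄‖·‖X − X̄‖∕a² + ‖ψ_{U₀}(X̄)c − Dψ_{U₀}(0)X̄ c‖` (`B = 54ℓ(e^a − 1)`)
# — Cauchy AT THE BASE POINT `X̄` + `Dψ` Lipschitz in the base point; with `X̄` the covariantly constant extension of `X`, `‖X − X̄‖ = OSC`, so (β-3)′ ⟸ ONE structural letter CONST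

Cell `ym3-torus` (YM ladder rung R3 = continuum `SU(2)` Yang–Mills on the three-torus at fixed lattice data — a RUNG: NOT d = 4, NOT infinite volume, NOT a mass gap,
NOT Clay).  Width seat `ym3-torus-px13` (gen 27); crux `stmt-QuantumFields-20520`, LINE g18-1 S2β, pairing lane; (SCT″-c)₁ source budget (S-SRC).  ARCHITECT RULING px17 g22 19:55:50Z
«(β-3)′ YES» (HAZARD «SRC-q (2)», px13 g27: the ADDITIVE Cauchy remainder `q·M²` of ✓(β-3) `…ChartReadSecondOrder` carries `log N` on smooth small-amplitude relative data; the cure is the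
ORDER-2 BRICK IN OSCILLATION + BACKGROUND-CURVATURE FORM `‖ψ(X) − Dψ(0)X‖ ≤ q·M·(OSC + M·κ)`).  THIS FILE is the analytic half that is already in the tree's reach: split `X = X̄ + δ` and
price `δ` by Cauchy's second-order estimate ALONG THE COMPLEX LINE THROUGH `δ̂` AT THE BASE POINT `X̄̂` (lit ✓`B7TransferAnalyticMean.norm_sub_sub_fderiv_le_of_line` on ✓(β-2)'s holomorphic,
bounded `Φ_c`) and the move of the derivative's base point by ✓(β-4) `norm_fderiv_chartRead_sub_fderiv_le`; the CONSTANT-FIELD remainder `‖ψ(X̄) − Dψ(0)X̄‖` is left as the one term the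
structural letter CONST («third-order smallness on covariantly constant fields», FILE B: the symmetric comb kills the second variation) must price.
`--kind proof --supports stmt-QuantumFields-20520 --as helper`, count-neutral, DEFINITION-FREE (ONE decl-local `set_option maxHeartbeats 400000 in` on the main theorem, README HEARTBEAT-BUDGET form — it elaborates in ≈ 10 s on the farm);
generic `P : Params`, `SU(N)`, N09 chart-read conventions of ✓(β-1)∕(β-2)∕(β-3)∕(β-4).

WHAT IS PROVED (sorry-free).  ★`cauchy_bound_mono`, ★`taylor_split`, ★★★`norm_chartRead_sub_fderiv_le_of_split` (the display above, polydisc form: `0 < a`, `100ℓ(e^a − 1) ≤ ρ`,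
`8‖X̄‖ ≤ a`, `4‖X − X̄‖ + ‖X̄‖ ≤ a`).

HONEST.  Composition of landed Cauchy letters; nothing of Bałaban's asserted ([Balaban1985Averaging] Prop. 3 (121)–(123), Prop. 4 (148)–(149) are print's order-2 ∕ Lipschitz statements
this serves); CONST (FILE B∕C), the OSC-lift letter, (RSP-Σ), (BKG), the rows v2, (ST″), (SCT″-c)₁₂₃, LOC, GAP♯∘ (`stub_uniformFibreGapOrbit`, registry 3732b7df UNTOUCHED, 0∕5), the five
REGISTERED stubs, S2β, crux 20520, 19936, 19200, `YM3TorusSU2` — NOT proved; rung R3 = SU(2) YM₃ on T³ — NOT d = 4, NOT infinite volume, NOT a mass gap, NOT Clay; the Yang–Mills mass gap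
is NOT proved.  Axioms standard.

References: [Balaban1985Averaging] CMP **98** (1985) Prop. 3 (121)–(123) p.36, Prop. 4 (148)–(149) p.40; [Balaban1987RG1] CMP **109** (1987) (0.4), (0.8) p.253.
-/

set_option autoImplicit false

noncomputable section

open scoped Matrix.Norms.L2Operator Topology
open Filter Set Function Metric

namespace Summit.QuantumFields.YangMills.Theorems.FluctuationComparisonRegPrIntLS2BetaChartReadOscSplit

open Literature.MathematicalPhysics.QuantumFieldTheory.Balaban1983to89
open Literature.MathematicalPhysics.QuantumFieldTheory.Balaban1983to89.HaarExponentialChart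
open Literature.MathematicalPhysics.QuantumFieldTheory.Balaban1983to89.HaarExponentialChart.IsChartRep
open Literature.MathematicalPhysics.QuantumFieldTheory.Balaban1983to89.BlockAveraging (Small Idx avgFun loopHol off corr)
open Literature.MathematicalPhysics.QuantumFieldTheory.Balaban1983to89.ExpMeanLog (eml expMeanLogSU deltaSU deltaSU_pos)
open Literature.MathematicalPhysics.QuantumFieldTheory.Balaban1983to89.Node00
open Literature.MathematicalPhysics.QuantumFieldTheory.Balaban1983to89.T4Continuum (walk holAt LStep loopWord)
open MatrixLog (mlog)
open Summit.QuantumFields.YangMills.BalabanUVNodes.N09ChartReadAveragingSmooth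
open Summit.QuantumFields.YangMills.Theorems.FluctuationComparisonRegPrIntLS2BetaChartReadCplxExtension
open Summit.QuantumFields.YangMills.Theorems.FluctuationComparisonRegPrIntLS2BetaChartReadCplxAnalytic
open Summit.QuantumFields.YangMills.Theorems.FluctuationComparisonRegPrIntLS2BetaChartReadSecondOrder (norm_cplxChartRead_le_of_mem_ball)
open Summit.QuantumFields.YangMills.Theorems.FluctuationComparisonRegPrIntLS2BetaChartReadDerivLipschitz (coe_fderiv_chartRead_apply_eq_at norm_fderiv_chartRead_sub_fderiv_le)

variable {P : Params} {j : ℕ} {N : ℕ} [NeZero N] (U₀ : GaugeField P j (SU N))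

omit [NeZero N] in
/-- ★ Monotonicity of Cauchy's bound `8·C·‖v‖²∕(a − ‖u‖)²` in `‖v‖` and `‖u‖`. [folklore] -/
theorem cauchy_bound_mono {C a nv nv' nu nu' : ℝ} (hC : 0 ≤ C) (hv : 0 ≤ nv) (hvv : nv ≤ nv') (huu : nu ≤ nu') (hu' : nu' < a) :
    8 * C * nv ^ 2 / (a - nu) ^ 2 ≤ 8 * C * nv' ^ 2 / (a - nu') ^ 2 := by
  have h1 : 0 < a - nu' := by linarith
  have h2 : 8 * C * nv ^ 2 ≤ 8 * C * nv' ^ 2 := by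
    have := pow_le_pow_left₀ hv hvv 2
    nlinarith
  calc 8 * C * nv ^ 2 / (a - nu) ^ 2 ≤ 8 * C * nv' ^ 2 / (a - nu) ^ 2 := div_le_div_of_nonneg_right h2 (pow_pos (by linarith) 2).le
    _ ≤ 8 * C * nv' ^ 2 / (a - nu') ^ 2 :=
        div_le_div_of_nonneg_left (by positivity) (pow_pos h1 2) (pow_le_pow_left₀ h1.le (by linarith) 2)

omit [NeZero N] in
/-- ★ The three-term Taylor split at a base point `u`: `Φ(u+v) − DΦ(0)(u+v) = [Φ(u+v) − Φ(u) − DΦ(u)v] + [DΦ(u)v − DΦ(0)v] + [Φ(u) − DΦ(0)u]`. [folklore] -/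
theorem taylor_split {E F : Type*} [NormedAddCommGroup E] [NormedSpace ℂ E] [NormedAddCommGroup F] [NormedSpace ℂ F] (Φ : E → F) (u v : E) :
    Φ (u + v) - fderiv ℂ Φ 0 (u + v) = (Φ (u + v) - Φ u - fderiv ℂ Φ u v) + (fderiv ℂ Φ u v - fderiv ℂ Φ 0 v) + (Φ u - fderiv ℂ Φ 0 u) := by
  rw [map_add]; abel

set_option maxHeartbeats 400000 in
/-- ★★★ **THE OSCILLATION SPLIT OF THE ORDER-2 CHART REMAINDER** (polydisc form: `0 < a`, `100ℓ(e^a − 1) ≤ ρ`, background in the loop guard with `4α ≤ ρ ≤` inner radius; reference field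
`X̄` with `8‖X̄‖ ≤ a`, perturbation `4‖X − X̄‖ + ‖X̄‖ ≤ a`):
`‖↑(ψ_{U₀}(X) c) − ↑((Dψ_{U₀}(0) X) c)‖ ≤ 8B·‖X − X̄‖²∕(a − ‖X̄‖)² + 32B·‖X − X̄‖·‖X̄‖∕a² + ‖↑(ψ_{U₀}(X̄) c) − ↑((Dψ_{U₀}(0) X̄) c)‖`, `B = 54ℓ(e^a − 1)` — the two `δ`-terms vanish when `X`
is its own reference (`X = X̄`), and the last term is the constant-field remainder CONST. [cite: Balaban1985Averaging, Prop. 3 (121)-(123) p.36, Prop. 4 (148)-(149) p.40] -/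
theorem norm_chartRead_sub_fderiv_le_of_split {α ρ : ℝ} (hρ0 : 0 < ρ) (hρ : ρ ≤ innerRadius (specialUnitaryLogChart (Fin N)))
    (hα : ∀ c i, dist1 (loopHol U₀ c i) ≤ α) (hα4 : 4 * α ≤ ρ)
    {a : ℝ} (ha0 : 0 < a) (ha : 100 * ((((P.d + 2) * P.L : ℕ) : ℝ) * (Real.exp a - 1)) ≤ ρ)
    (X Xb : PBond P j → (specialUnitaryLogChart (Fin N)).lie) (hXb : 8 * ‖Xb‖ ≤ a) (hX : 4 * ‖X - Xb‖ + ‖Xb‖ ≤ a) (c : PBond P (j + 1)) :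
    ‖((((fun (A : PBond P j → (specialUnitaryLogChart (Fin N)).lie) (c : PBond P (j + 1)) => (isChartRep_specialUnitaryGroup (n := Fin N)).logChart (avgFun (expMeanLogSU (n := Fin N)) (fun b => (isChartRep_specialUnitaryGroup (n := Fin N)).expChart (A b) * U₀ b) c * (avgFun (expMeanLogSU (n := Fin N)) U₀ c)⁻¹))) X c : (specialUnitaryLogChart (Fin N)).lie) : Matrix (Fin N) (Fin N) ℂ) -
        ((fderiv ℝ (fun (A : PBond P j → (specialUnitaryLogChart (Fin N)).lie) (c : PBond P (j + 1)) => (isChartRep_specialUnitaryGroup (n := Fin N)).logChart (avgFun (expMeanLogSU (n := Fin N)) (fun b => (isChartRep_specialUnitaryGroup (n := Fin N)).expChart (A b) * U₀ b) c * (avgFun (expMeanLogSU (n := Fin N)) U₀ c)⁻¹)) 0 X c : (specialUnitaryLogChart (Fin N)).lie) : Matrix (Fin N) (Fin N) ℂ)‖ ≤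
      8 * (54 * ((((P.d + 2) * P.L : ℕ) : ℝ) * (Real.exp a - 1))) * ‖X - Xb‖ ^ 2 / (a - ‖Xb‖) ^ 2 +
        32 * (54 * ((((P.d + 2) * P.L : ℕ) : ℝ) * (Real.exp a - 1))) * ‖X - Xb‖ * ‖Xb‖ / a ^ 2 +
        ‖((((fun (A : PBond P j → (specialUnitaryLogChart (Fin N)).lie) (c : PBond P (j + 1)) => (isChartRep_specialUnitaryGroup (n := Fin N)).logChart (avgFun (expMeanLogSU (n := Fin N)) (fun b => (isChartRep_specialUnitaryGroup (n := Fin N)).expChart (A b) * U₀ b) c * (avgFun (expMeanLogSU (n := Fin N)) U₀ c)⁻¹))) Xb c : (specialUnitaryLogChart (Fin N)).lie) : Matrix (Fin N) (Fin N) ℂ) -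
          ((fderiv ℝ (fun (A : PBond P j → (specialUnitaryLogChart (Fin N)).lie) (c : PBond P (j + 1)) => (isChartRep_specialUnitaryGroup (n := Fin N)).logChart (avgFun (expMeanLogSU (n := Fin N)) (fun b => (isChartRep_specialUnitaryGroup (n := Fin N)).expChart (A b) * U₀ b) c * (avgFun (expMeanLogSU (n := Fin N)) U₀ c)⁻¹)) 0 Xb c : (specialUnitaryLogChart (Fin N)).lie) : Matrix (Fin N) (Fin N) ℂ)‖ := by
  -- sizes
  have hXa : ‖X‖ ≤ a := by
    have : ‖X‖ ≤ ‖X - Xb‖ + ‖Xb‖ := by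
      calc ‖X‖ = ‖(X - Xb) + Xb‖ := by rw [sub_add_cancel]
        _ ≤ ‖X - Xb‖ + ‖Xb‖ := norm_add_le _ _
    linarith [norm_nonneg (X - Xb)]
  have hXba : ‖Xb‖ < a := by linarith [norm_nonneg Xb]
  have hB0 : 0 ≤ 54 * ((((P.d + 2) * P.L : ℕ) : ℝ) * (Real.exp a - 1)) := by
    have : 0 ≤ Real.exp a - 1 := by linarith [Real.add_one_le_exp a]
    positivity
  have hexp : ∀ {Y : PBond P j → (specialUnitaryLogChart (Fin N)).lie}, ‖Y‖ ≤ a → 100 * ((((P.d + 2) * P.L : ℕ) : ℝ) * (Real.exp ‖Y‖ - 1)) ≤ ρ := by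
    intro Y hY
    have hmono : Real.exp ‖Y‖ - 1 ≤ Real.exp a - 1 := by linarith [Real.exp_le_exp.2 hY]
    exact le_trans (by gcongr) ha
  have hexp_lt : 100 * ((((P.d + 2) * P.L : ℕ) : ℝ) * (Real.exp ‖Xb‖ - 1)) < ρ := by
    have hmono : Real.exp ‖Xb‖ - 1 < Real.exp a - 1 := by linarith [Real.exp_lt_exp.2 hXba]
    calc 100 * ((((P.d + 2) * P.L : ℕ) : ℝ) * (Real.exp ‖Xb‖ - 1)) < 100 * ((((P.d + 2) * P.L : ℕ) : ℝ) * (Real.exp a - 1)) := by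
          have hℓ0 : (0 : ℝ) < (((P.d + 2) * P.L : ℕ) : ℝ) := by exact_mod_cast Nat.pos_of_ne_zero (Nat.mul_ne_zero (by omega) P.L_pos.ne')
          gcongr
      _ ≤ ρ := ha
  -- the coerced fields and their additivity
  have hXbh : ‖(fun b => ((Xb b : (specialUnitaryLogChart (Fin N)).lie) : Matrix (Fin N) (Fin N) ℂ))‖ ≤ ‖Xb‖ := norm_coePi_le Xb
  have hδh : ‖(fun b => (((X - Xb) b : (specialUnitaryLogChart (Fin N)).lie) : Matrix (Fin N) (Fin N) ℂ))‖ ≤ ‖X - Xb‖ := norm_coePi_le (X - Xb)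
  have hcoe_add : (fun b => ((Xb b : (specialUnitaryLogChart (Fin N)).lie) : Matrix (Fin N) (Fin N) ℂ)) + (fun b => (((X - Xb) b : (specialUnitaryLogChart (Fin N)).lie) : Matrix (Fin N) (Fin N) ℂ)) = (fun b => ((X b : (specialUnitaryLogChart (Fin N)).lie) : Matrix (Fin N) (Fin N) ℂ)) := by
    funext b
    simp only [Pi.add_apply, Pi.sub_apply, ← Submodule.coe_add, add_sub_cancel]
  -- the real-slice identities (✓(β-2), ✓(β-4))
  have hψX := coe_chartRead_eq_cplxChartRead U₀ c hρ (hα c) hα4 hρ0 X (hexp hXa)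
  have hψXb := coe_chartRead_eq_cplxChartRead U₀ c hρ (hα c) hα4 hρ0 Xb (hexp hXba.le)
  have hDψXb := coe_fderiv_chartRead_apply_eq_at U₀ hρ0 hρ hα hα4 Xb hexp_lt (X - Xb) c
  have hDψ0X := coe_fderiv_chartRead_apply_eq U₀ hρ hα hα4 hρ0 X c
  have hDψ0Xb := coe_fderiv_chartRead_apply_eq U₀ hρ hα hα4 hρ0 Xb c
  have hDψ0δ := coe_fderiv_chartRead_apply_eq U₀ hρ hα hα4 hρ0 (X - Xb) c
  -- the split at the complex level, read on the real slice
  have hid := taylor_split (fun A : PBond P j → Matrix (Fin N) (Fin N) ℂ => mlog (eml (fun i : Idx P => ((walk (emb c.src) (loopWord P.L c.dir (off i.1) i.2.1 i.2.2)).map (fun s : LStep P j => if s.fwd then NormedSpace.exp (A s.bond) * ((U₀ s.bond : SU N) : Matrix (Fin N) (Fin N) ℂ) else star ((U₀ s.bond : SU N) : Matrix (Fin N) (Fin N) ℂ) * NormedSpace.exp (-(A s.bond)))).prod) * ((walk (emb c.src) (List.replicate P.L (c.dir, true))).map (fun s : LStep P j => if s.fwd then NormedSpace.exp (A s.bond)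 * ((U₀ s.bond : SU N) : Matrix (Fin N) (Fin N) ℂ) else star ((U₀ s.bond : SU N) : Matrix (Fin N) (Fin N) ℂ) * NormedSpace.exp (-(A s.bond)))).prod * star ((avgFun (expMeanLogSU (n := Fin N)) U₀ c : SU N) : Matrix (Fin N) (Fin N) ℂ))) (fun b => ((Xb b : (specialUnitaryLogChart (Fin N)).lie) : Matrix (Fin N) (Fin N) ℂ)) (fun b => (((X - Xb) b : (specialUnitaryLogChart (Fin N)).lie) : Matrix (Fin N) (Fin N) ℂ))
  have key := congrArg (fun M : Matrix (Fin N) (Fin N) ℂ => ‖M‖) hid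
  simp only [] at key
  have key' := (le_of_eq key).trans norm_add₃_le
  rw [hcoe_add] at key'
  rw [← hψX, ← hψXb, ← hDψXb, ← hDψ0X, ← hDψ0Xb, ← hDψ0δ] at key'
  -- TERM 1: Cauchy at the base point `X̄̂`
  have hΦd := differentiableOn_cplxChartRead U₀ c hρ (hα c) hα4 ha
  have hBall := norm_cplxChartRead_le_of_mem_ball U₀ c hρ (hα c) hα4 ha
  have hu : (fun b => ((Xb b : (specialUnitaryLogChart (Fin N)).lie) : Matrix (Fin N) (Fin N) ℂ)) ∈ ball (0 : PBond P j → Matrix (Fin N) (Fin N) ℂ) a := by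
    rw [mem_ball_zero_iff]; exact lt_of_le_of_lt hXbh hXba
  have hv : 4 * ‖(fun b => (((X - Xb) b : (specialUnitaryLogChart (Fin N)).lie) : Matrix (Fin N) (Fin N) ℂ))‖ ≤ a - ‖(fun b => ((Xb b : (specialUnitaryLogChart (Fin N)).lie) : Matrix (Fin N) (Fin N) ℂ)) - 0‖ := by
    rw [sub_zero]; linarith [norm_nonneg (X - Xb)]
  have h1 := B7TransferAnalyticMean.norm_sub_sub_fderiv_le_of_line hΦd hBall hu hv
  rw [sub_zero, hcoe_add] at h1
  rw [← hψX, ← hψXb, ← hDψXb] at h1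
  have h1' := h1.trans (cauchy_bound_mono hB0 (norm_nonneg _) hδh hXbh hXba)
  -- TERM 2: the derivative's base point moves from `X̄` to `0` (✓(β-4))
  have h2 := norm_fderiv_chartRead_sub_fderiv_le U₀ hρ0 hρ hα hα4 ha0 ha Xb (by linarith) (X - Xb) c
  linarith [key', h1', h2]

end Summit.QuantumFields.YangMills.Theorems.FluctuationComparisonRegPrIntLS2BetaChartReadOscSplit

end
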